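import Literature.Analysis.FunctionSpaces.LittlewoodPaleyCommutator
import Literature.Analysis.FluidPDE.BlockLipschitz
import Literature.Analysis.FluidPDE.TrilinearBlockExpansion
import Literature.Analysis.FluidPDE.CheskidovShvydkoyDyadicEnergy
import HarnessLib

/-!
# The pieces of the nonlinear term in LOW-MODE form (Cheskidov–Dai): Hölder, Bernstein, commutator

Analysis/FluidPDE support file (serves the discharge of the named fact
`Literature.Analysis.FluidPDE.cheskidov_dai_occupation_regular` — Cheskidov–Dai, *Regularity criteria
for the 3D Navier–Stokes and MHD equations*, arXiv:1507.06611 = Proc. Edinburgh Math. Soc. (2025),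
Thm. 1.1, Navier–Stokes case). §3.1 of the paper bounds the flux `I = ∑_q λ_q^{2s} ∫ Δ_q(u·∇u)·u_q` by
(3.6): `|I| ≲ c_r ν ∑_{q > Q-3} λ_q^{2s+2}‖u_q‖₂² + f(t) ∑_q λ_q^{2s}‖u_q‖₂²` with the LOW-MODE factor
`f(t) = ∑_{q ≤ Q(t)} λ_q ‖u_q‖_∞` — LINEAR in `f`, which is what the occupation bootstrap of Thm. 1.1
needs (the tree's Cheskidov–Shvydkoy estimate `paraproduct_weighted_sum_le` integrates by parts first and
is quadratic in the low-frequency factor after Young's inequality).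

This file provides the bounds on the single block pieces of `N_j = ∫ ⟪Δ̇_j v, Δ̇_j((v·∇)v)⟫` in the
tree's `H¹` dyadic language (`CheskidovShvydkoyNonlinear`, trilinear pieces `𝒯_j(g; e; f, w)` with the
derivative KEPT on the second factor, `w = ∂_i z`):

* `integral_inner_blockFn_convect_eq_sum_trilin` — `∫ ⟪g, Δ̇_j((f·∇)z)⟫ = ∑_i 𝒯_j(g; b_i; f, ∂_i z)`;
* `enorm_trilin_fderiv_blockFn_le_highLow` / `_lowHigh` / `_diag` — Hölder and Bernstein with the sup
  norm on the lowest block present (the paper's `I₁₁₁/I₂`, `I₁₃₁`, `I₃` terms);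
* `sum_trilin_eq_transport_add_comm` — the commutator form of a low–high piece,
  `∑_i 𝒯_j(g; b_i; f, ∂_i z) = ∫ ⟪g, (f·∇)Δ̇_j z⟫ + ∑_i ∫ ⟪g, [Δ̇_j, f_i] ∂_i z⟫` (`I₁ = I₁₁ + I₁₂ + I₁₃`);
* `enorm_integral_inner_comm_le` — the commutator piece costs `Lip(Δ̇_l v) · 2^{-j} M₁ · C_b 2^{l'} a_{l'}`
  (`LittlewoodPaleyCommutator`, the paper's (3.5));
* `sum_window_integral_inner_transport_eq_zero` — the transport parts cancel over the window
  `|l' - j| ≤ 2` (`∑ Δ̇_j Δ̇_{l'} v = Δ̇_j v`, `BlockLipschitz`; skewness, `TrilinearBlockExpansion`).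

The block-by-block assembly is `CheskidovDaiNonlinear.lean`.

## References

* A. Cheskidov, M. Dai, arXiv:1507.06611 = Proc. Edinburgh Math. Soc. (2025), §3.1, (3.5)–(3.6).
  [CheskidovDai2015]
* H. Bahouri, J.-Y. Chemin, R. Danchin, *Fourier Analysis and Nonlinear PDE*, Springer 2011, §2.6–2.8,
  Lemma 2.97. [BahouriCheminDanchin2011]
-/

noncomputable section

open MeasureTheory Filter Topology Function Set
open Literature.Analysis.FunctionSpaces
open scoped ENNReal NNReal RealInnerProductSpace

namespace Literature.Analysis.FluidPDE

section Pieces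

variable {ι : Type*} [Fintype ι]

/-! ## The nonlinear term as a sum of trilinear pieces (no integration by parts) -/

/-- The convective derivative along an orthonormal frame: `(f·∇)z (y) = ∑_i ⟪f y, b_i⟫ • ∂_{b_i} z (y)`. [folklore] -/
private theorem convect_eq_sum_inner_smul_fderiv (f : EuclideanSpace ℝ ι → EuclideanSpace ℝ ι)
    (z : EuclideanSpace ℝ ι → EuclideanSpace ℝ ι) (y : EuclideanSpace ℝ ι) :
    convect f z y = ∑ i, ⟪f y, stdOrthonormalBasis ℝ (EuclideanSpace ℝ ι) i⟫ •
      fderiv ℝ z y (stdOrthonormalBasis ℝ (EuclideanSpace ℝ ι) i) := by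
  set b := stdOrthonormalBasis ℝ (EuclideanSpace ℝ ι)
  rw [convect_apply]
  conv_lhs => rw [← b.sum_repr' (f y)]
  simp only [map_sum, map_smul, real_inner_comm (f y)]

/-- **The nonlinear term of the `j`-th block balance as trilinear pieces, derivative kept on the second
factor**: for a smooth `L²` field `v` and a bounded `f` with bounded derivatives,
`∫ ⟪g, Δ̇_j((f·∇)z)⟫ = ∑_i 𝒯_j(g; b_i; f, ∂_{b_i} z)` (Cheskidov–Dai keep `Δ_q(u_{≤p-2}·∇u_p)` in this
form instead of the divergence form of Cheskidov–Shvydkoy). [cite: CheskidovDai2015, §3.1 (decomposition of I)] -/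
theorem integral_inner_blockFn_convect_eq_sum_trilin (j : ℤ) {g f z : EuclideanSpace ℝ ι → EuclideanSpace ℝ ι}
    (hg : MemLp g 2 volume) (hf : HasBoundedDerivs f) (hz : IsSmoothL2Field z) :
    ∫ x, ⟪g x, blockFn j (convect f z) x⟫ =
      ∑ i, trilin j g (stdOrthonormalBasis ℝ (EuclideanSpace ℝ ι) i) f
        (fun y => fderiv ℝ z y (stdOrthonormalBasis ℝ (EuclideanSpace ℝ ι) i)) := by
  haveI : Fact (1 ≤ (2 : ℝ≥0∞)) := ⟨one_le_two⟩
  set b := stdOrthonormalBasis ℝ (EuclideanSpace ℝ ι)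
  have hft : MemLp f ∞ volume := memLp_top_of_hasBoundedDerivs hf
  have hwi : ∀ i, MemLp (fun y => fderiv ℝ z y (b i)) 2 volume := fun i => hz.memLp_fderiv_apply (b i)
  have hpiece : ∀ i, MemLp (fun y => ⟪f y, b i⟫ • fderiv ℝ z y (b i)) 2 volume := fun i =>
    memLp_inner_smul_of_top (b i) hft (hwi i)
  have hconv : convect f z = ∑ i, fun y => ⟪f y, b i⟫ • fderiv ℝ z y (b i) := by
    funext y; rw [convect_eq_sum_inner_smul_fderiv f z y, Finset.sum_apply]
  rw [hconv, blockFn_sum j _ fun i _ => hpiece i]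
  have hint : ∀ i, Integrable (fun x => ⟪g x, blockFn j (fun y => ⟪f y, b i⟫ • fderiv ℝ z y (b i)) x⟫) volume :=
    fun i => integrable_inner_of_memLp_two hg (memLp_blockFn j (hpiece i) one_le_two)
  have hsum : ∀ x, ⟪g x, (∑ i, fun y => blockFn j (fun y => ⟪f y, b i⟫ • fderiv ℝ z y (b i)) y) x⟫ =
      ∑ i, ⟪g x, blockFn j (fun y => ⟪f y, b i⟫ • fderiv ℝ z y (b i)) x⟫ := by
    intro x; rw [Finset.sum_apply, inner_sum]
  have hfun : (∑ i, blockFn j (fun y => ⟪f y, b i⟫ • fderiv ℝ z y (b i))) =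
      ∑ i, fun y => blockFn j (fun y => ⟪f y, b i⟫ • fderiv ℝ z y (b i)) y := rfl
  rw [hfun]
  simp_rw [hsum]
  rw [integral_finsetSum _ fun i _ => hint i]
  rfl

/-! ## Bounds on single pieces -/

omit [Fintype ι] in
/-- `‖⟪a, b⟫‖ₑ ≤ ‖a‖ₑ ‖b‖ₑ` (Cauchy–Schwarz in `ℝ≥0∞`). [folklore] -/
private theorem enorm_inner_le_enorm_mul_enorm {F : Type*} [NormedAddCommGroup F] [InnerProductSpace ℝ F]
    (a c : F) : ‖⟪a, c⟫‖ₑ ≤ ‖a‖ₑ * ‖c‖ₑ := by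
  rw [← ofReal_norm, ← ofReal_norm, ← ofReal_norm, ← ENNReal.ofReal_mul (norm_nonneg _)]
  exact ENNReal.ofReal_le_ofReal (norm_inner_le_norm _ _)

/-- `‖∫ ⟪g, h⟫‖ ≤ ‖g‖_∞ ‖h‖₁` (Hölder). [folklore] -/
private theorem enorm_integral_inner_le_top_one {g h : EuclideanSpace ℝ ι → EuclideanSpace ℝ ι}
    (hh : AEStronglyMeasurable h volume) :
    ‖∫ x, ⟪g x, h x⟫‖ₑ ≤ eLpNorm g ∞ volume * eLpNorm h 1 volume := by
  refine (enorm_integral_le_lintegral_enorm _).trans ?_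
  rw [eLpNorm_one_eq_lintegral_enorm, ← lintegral_const_mul'' _ hh.enorm, eLpNorm_exponent_top]
  refine lintegral_mono_ae ?_
  filter_upwards [enorm_ae_le_eLpNormEssSup g volume] with x hx
  exact (enorm_inner_le_enorm_mul_enorm _ _).trans (mul_le_mul_left hx _)

/-- `‖f‖₂ = (∫ ‖f‖ₑ²)^{1/2}`. [folklore] -/
private theorem eLpNorm_two_eq_lintegral_sqrt (φ : EuclideanSpace ℝ ι → EuclideanSpace ℝ ι) :
    eLpNorm φ 2 (volume : Measure (EuclideanSpace ℝ ι)) = (∫⁻ x, ‖φ x‖ₑ ^ 2) ^ (1 / 2 : ℝ) := by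
  rw [eLpNorm_eq_lintegral_rpow_enorm_toReal two_ne_zero ENNReal.ofNat_ne_top, ENNReal.toReal_ofNat]
  simp_rw [ENNReal.rpow_two]

/-- `‖∫ ⟪g, h⟫‖ ≤ ‖g‖₂ ‖h‖₂` (Cauchy–Schwarz). [folklore] -/
private theorem enorm_integral_inner_le_two_two {g h : EuclideanSpace ℝ ι → EuclideanSpace ℝ ι}
    (hg : AEStronglyMeasurable g volume) (hh : AEStronglyMeasurable h volume) :
    ‖∫ x, ⟪g x, h x⟫‖ₑ ≤ eLpNorm g 2 volume * eLpNorm h 2 volume := by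
  refine (enorm_integral_le_lintegral_enorm _).trans ?_
  rw [eLpNorm_two_eq_lintegral_sqrt, eLpNorm_two_eq_lintegral_sqrt]
  exact IsRegularSlab.lintegral_enorm_inner_le hg hh

/-- `‖⟪f, e⟫ • w‖₁ ≤ ‖f‖₂ ‖w‖₂` for `‖e‖ ≤ 1` (Hölder). [folklore] -/
private theorem eLpNorm_inner_smul_le_two_two {f w : EuclideanSpace ℝ ι → EuclideanSpace ℝ ι}
    {e : EuclideanSpace ℝ ι} (he : ‖e‖ ≤ 1) (hf : AEStronglyMeasurable f volume) (hw : AEStronglyMeasurable w volume) :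
    eLpNorm (fun y => ⟪f y, e⟫ • w y) 1 volume ≤ eLpNorm f 2 volume * eLpNorm w 2 volume := by
  have h1 : eLpNorm ((fun y => ⟪f y, e⟫) • w) 1 volume ≤ eLpNorm (fun y => ⟪f y, e⟫) 2 volume * eLpNorm w 2 volume :=
    eLpNorm_smul_le_mul_eLpNorm (p := 2) (q := 2) (r := 1) hw (hf.inner aestronglyMeasurable_const)
  have h0 : eLpNorm (fun y => ⟪f y, e⟫ • w y) 1 volume = eLpNorm ((fun y => ⟪f y, e⟫) • w) 1 volume := rfl
  rw [h0]
  refine h1.trans (mul_le_mul_left (eLpNorm_mono fun y => ?_) _)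
  calc ‖⟪f y, e⟫‖ ≤ ‖f y‖ * ‖e‖ := norm_inner_le_norm _ _
    _ ≤ ‖f y‖ * 1 := by gcongr
    _ = ‖f y‖ := mul_one _

variable (j : ℤ) {g f : EuclideanSpace ℝ ι → EuclideanSpace ℝ ι} {v : EuclideanSpace ℝ ι → EuclideanSpace ℝ ι}

/-- **High–low piece** (sup on the LOW derivative block): for `g, f ∈ L²` and a smooth `L²` field `v`,
`‖𝒯_j(g; b_i; f, ∂_i Δ̇_{l'} v)‖ ≤ ‖g‖₂ C₂ ‖f‖₂ ‖∂_i Δ̇_{l'} v‖_∞ ≤ ‖g‖₂ C₂ ‖f‖₂ (C_∞' 2^{l'} ‖Δ̇_{l'} v‖_∞)`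
(Cheskidov–Dai's `I₂`/`I₁₁₁`-type terms: Hölder and Bernstein on the low block). [cite: CheskidovDai2015, §3.1 (estimate of I₁₁₁, I₂)] -/
theorem enorm_trilin_fderiv_blockFn_le_highLow (hg : MemLp g 2 volume) (hf : MemLp f 2 volume)
    (hv : IsSmoothL2Field v) {C₂ : ℝ≥0∞}
    (hC₂ : ∀ F : EuclideanSpace ℝ ι → EuclideanSpace ℝ ι, MemLp F 2 volume → eLpNorm (blockFn j F) 2 volume ≤ C₂ * eLpNorm F 2 volume)
    {Csup : ℝ≥0} (hCsup : ∀ (m : EuclideanSpace ℝ ι) (l : ℤ) (w : EuclideanSpace ℝ ι → EuclideanSpace ℝ ι), IsC1L2Field w →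
      eLpNorm (fun x => fderiv ℝ (blockFn l w) x m) ∞ volume ≤ Csup * ENNReal.ofReal ((2 : ℝ) ^ l * ‖m‖) * eLpNorm (blockFn l w) ∞ volume)
    (i : Fin (Module.finrank ℝ (EuclideanSpace ℝ ι))) (l' : ℤ) :
    ‖trilin j g (stdOrthonormalBasis ℝ (EuclideanSpace ℝ ι) i) f
        (fun y => fderiv ℝ (blockFn l' v) y (stdOrthonormalBasis ℝ (EuclideanSpace ℝ ι) i))‖ₑ ≤
      eLpNorm g 2 volume * C₂ * eLpNorm f 2 volume *
        (Csup * ENNReal.ofReal ((2 : ℝ) ^ l') * eLpNorm (blockFn l' v) ∞ volume) := by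
  haveI : Fact (1 ≤ (2 : ℝ≥0∞)) := ⟨one_le_two⟩
  set b := stdOrthonormalBasis ℝ (EuclideanSpace ℝ ι)
  have hw : MemLp (fun y => fderiv ℝ (blockFn l' v) y (b i)) ∞ volume :=
    memLp_top_of_hasBoundedDerivs ((hv.blockFn l').fderiv_apply (b i)).toHasBoundedDerivs
  have hflux : MemLp (fun y => ⟪f y, b i⟫ • fderiv ℝ (blockFn l' v) y (b i)) 2 volume := memLp_inner_smul_of_two (b i) hf hw
  have hsup := hCsup (b i) l' v (IsC1L2Field.of_isSmoothL2Field hv)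
  rw [b.orthonormal.1 i, mul_one] at hsup
  calc ‖trilin j g (b i) f (fun y => fderiv ℝ (blockFn l' v) y (b i))‖ₑ
      ≤ eLpNorm g 2 volume * eLpNorm (blockFn j (fun y => ⟪f y, b i⟫ • fderiv ℝ (blockFn l' v) y (b i))) 2 volume :=
        enorm_trilin_le j hg.1 (b i) hflux.1
    _ ≤ eLpNorm g 2 volume * (C₂ * (eLpNorm f 2 volume * eLpNorm (fun y => fderiv ℝ (blockFn l' v) y (b i)) ∞ volume)) := by
        gcongr
        exact (hC₂ _ hflux).trans (mul_le_mul_right (eLpNorm_inner_smul_le_two_top (le_of_eq (b.orthonormal.1 i)) hf.1) _)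
    _ ≤ eLpNorm g 2 volume * (C₂ * (eLpNorm f 2 volume * (Csup * ENNReal.ofReal ((2 : ℝ) ^ l') * eLpNorm (blockFn l' v) ∞ volume))) := by
        gcongr
    _ = _ := by ring

/-- **Low–high piece near the diagonal** (sup on the LOW factor, Bernstein on the derivative):
`‖𝒯_j(g; b_i; f, ∂_i Δ̇_{l'} v)‖ ≤ ‖g‖₂ C₂ ‖f‖_∞ ‖∂_i Δ̇_{l'} v‖₂ ≤ ‖g‖₂ C₂ ‖f‖_∞ (C_b 2^{l'} ‖Δ̇_{l'} v‖₂)`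
(the terms `I₁₃₁` of the paper). [cite: CheskidovDai2015, §3.1 (estimate of I₁₃₁)] -/
theorem enorm_trilin_fderiv_blockFn_le_lowHigh (K : LPBounds ι) (hg : MemLp g 2 volume) (hf : MemLp f ∞ volume)
    (hv : IsSmoothL2Field v) (i : Fin (Module.finrank ℝ (EuclideanSpace ℝ ι))) (l' : ℤ) :
    ‖trilin j g (stdOrthonormalBasis ℝ (EuclideanSpace ℝ ι) i) f
        (fun y => fderiv ℝ (blockFn l' v) y (stdOrthonormalBasis ℝ (EuclideanSpace ℝ ι) i))‖ₑ ≤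
      eLpNorm g 2 volume * K.C₂ * eLpNorm f ∞ volume *
        (K.Cb * ENNReal.ofReal ((2 : ℝ) ^ l') * blockL2 v l') := by
  haveI : Fact (1 ≤ (2 : ℝ≥0∞)) := ⟨one_le_two⟩
  set b := stdOrthonormalBasis ℝ (EuclideanSpace ℝ ι)
  have hw : MemLp (fun y => fderiv ℝ (blockFn l' v) y (b i)) 2 volume := (hv.blockFn l').memLp_fderiv_apply (b i)
  have hflux : MemLp (fun y => ⟪f y, b i⟫ • fderiv ℝ (blockFn l' v) y (b i)) 2 volume := memLp_inner_smul_of_top (b i) hf hw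
  have hbern := K.bernstein (b i) l' v hv
  rw [b.orthonormal.1 i, mul_one] at hbern
  calc ‖trilin j g (b i) f (fun y => fderiv ℝ (blockFn l' v) y (b i))‖ₑ
      ≤ eLpNorm g 2 volume * eLpNorm (blockFn j (fun y => ⟪f y, b i⟫ • fderiv ℝ (blockFn l' v) y (b i))) 2 volume :=
        enorm_trilin_le j hg.1 (b i) hflux.1
    _ ≤ eLpNorm g 2 volume * (K.C₂ * (eLpNorm f ∞ volume * eLpNorm (fun y => fderiv ℝ (blockFn l' v) y (b i)) 2 volume)) := by
        gcongr
        exact (K.two_le j _ hflux).trans (mul_le_mul_right (eLpNorm_inner_smul_le_top_two (le_of_eq (b.orthonormal.1 i)) hw.1) _)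
    _ ≤ eLpNorm g 2 volume * (K.C₂ * (eLpNorm f ∞ volume * (K.Cb * ENNReal.ofReal ((2 : ℝ) ^ l') * blockL2 v l'))) := by
        gcongr; exact hbern
    _ = _ := by ring

/-- **Diagonal piece** (sup on the TESTED block, `L¹` on the product of the two high blocks):
`‖𝒯_j(g; b_i; f, ∂_i Δ̇_{l'} v)‖ ≤ ‖g‖_∞ ‖K₀‖₁ ‖f‖₂ ‖∂_i Δ̇_{l'} v‖₂ ≤ ‖g‖_∞ ‖K₀‖₁ ‖f‖₂ (C_b 2^{l'} ‖Δ̇_{l'} v‖₂)`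
(the terms `I₃` of the paper: `∑_q λ_q^{2s+1}‖u_q‖_∞ ∑_{p ≥ q-2} ‖u_p‖₂²`). [cite: CheskidovDai2015, §3.1 (estimate of I₃)] -/
theorem enorm_trilin_fderiv_blockFn_le_diag (K : LPBounds ι) (hf : MemLp f 2 volume)
    (hv : IsSmoothL2Field v) (i : Fin (Module.finrank ℝ (EuclideanSpace ℝ ι))) (l' : ℤ) :
    ‖trilin j g (stdOrthonormalBasis ℝ (EuclideanSpace ℝ ι) i) f
        (fun y => fderiv ℝ (blockFn l' v) y (stdOrthonormalBasis ℝ (EuclideanSpace ℝ ι) i))‖ₑ ≤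
      eLpNorm g ∞ volume * (∫⁻ z, ‖blockKernel (EuclideanSpace ℝ ι) 0 z‖ₑ) * eLpNorm f 2 volume *
        (K.Cb * ENNReal.ofReal ((2 : ℝ) ^ l') * blockL2 v l') := by
  set b := stdOrthonormalBasis ℝ (EuclideanSpace ℝ ι)
  have hw : MemLp (fun y => fderiv ℝ (blockFn l' v) y (b i)) 2 volume := (hv.blockFn l').memLp_fderiv_apply (b i)
  have hwt : MemLp (fun y => fderiv ℝ (blockFn l' v) y (b i)) ∞ volume :=
    memLp_top_of_hasBoundedDerivs ((hv.blockFn l').fderiv_apply (b i)).toHasBoundedDerivs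
  have hflux1 : AEStronglyMeasurable (fun y => ⟪f y, b i⟫ • fderiv ℝ (blockFn l' v) y (b i)) volume :=
    (memLp_inner_smul_of_two (b i) hf hwt).1
  have hbern := K.bernstein (b i) l' v hv
  rw [b.orthonormal.1 i, mul_one] at hbern
  unfold trilin
  calc ‖∫ x, ⟪g x, blockFn j (fun y => ⟪f y, b i⟫ • fderiv ℝ (blockFn l' v) y (b i)) x⟫‖ₑ
      ≤ eLpNorm g ∞ volume * eLpNorm (blockFn j (fun y => ⟪f y, b i⟫ • fderiv ℝ (blockFn l' v) y (b i))) 1 volume :=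
        enorm_integral_inner_le_top_one (aestronglyMeasurable_blockFn j hflux1)
    _ ≤ eLpNorm g ∞ volume * ((∫⁻ z, ‖blockKernel (EuclideanSpace ℝ ι) 0 z‖ₑ) *
          (eLpNorm f 2 volume * eLpNorm (fun y => fderiv ℝ (blockFn l' v) y (b i)) 2 volume)) := by
        gcongr
        rw [← lintegral_enorm_blockKernel_eq_zero_scale j]
        exact (eLpNorm_blockFn_le j hflux1 le_rfl).trans
          (mul_le_mul_right (eLpNorm_inner_smul_le_two_two (le_of_eq (b.orthonormal.1 i)) hf.1 hw.1) _)
    _ ≤ eLpNorm g ∞ volume * ((∫⁻ z, ‖blockKernel (EuclideanSpace ℝ ι) 0 z‖ₑ) *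
          (eLpNorm f 2 volume * (K.Cb * ENNReal.ofReal ((2 : ℝ) ^ l') * blockL2 v l'))) := by
        gcongr; exact hbern
    _ = _ := by ring

/-! ## The far low–high pieces: transport plus commutator -/

/-- **Commutator form of a low–high piece** (Cheskidov–Dai's split `I₁ = I₁₁ + I₁₂ + I₁₃`, the
commutator `[Δ_q, u_{≤p-2}·∇]u_p` and the transport term `u_{≤p-2}·∇Δ_q u_p`): for a bounded `f` with
bounded derivatives, `g ∈ L²` and a smooth `L²` field `z`,
`∑_i 𝒯_j(g; b_i; f, ∂_i z) = ∫ ⟪g, (f·∇)(Δ̇_j z)⟫ + ∑_i ∫ ⟪g, Δ̇_j(f_i ∂_i z) - f_i Δ̇_j(∂_i z)⟫`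
(`Δ̇_j ∂_i z = ∂_i Δ̇_j z`). [cite: CheskidovDai2015, §3.1 (I₁ = I₁₁ + I₁₂ + I₁₃)] -/
theorem sum_trilin_eq_transport_add_comm (hg : MemLp g 2 volume) (hf : HasBoundedDerivs f)
    {z : EuclideanSpace ℝ ι → EuclideanSpace ℝ ι} (hz : IsSmoothL2Field z) :
    ∑ i, trilin j g (stdOrthonormalBasis ℝ (EuclideanSpace ℝ ι) i) f
        (fun y => fderiv ℝ z y (stdOrthonormalBasis ℝ (EuclideanSpace ℝ ι) i)) =
      (∫ x, ⟪g x, convect f (blockFn j z) x⟫) +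
      ∑ i, ∫ x, ⟪g x,
        blockFn j (fun y => ⟪f y, stdOrthonormalBasis ℝ (EuclideanSpace ℝ ι) i⟫ •
            fderiv ℝ z y (stdOrthonormalBasis ℝ (EuclideanSpace ℝ ι) i)) x -
          ⟪f x, stdOrthonormalBasis ℝ (EuclideanSpace ℝ ι) i⟫ •
            blockFn j (fun y => fderiv ℝ z y (stdOrthonormalBasis ℝ (EuclideanSpace ℝ ι) i)) x⟫ := by
  haveI : Fact (1 ≤ (2 : ℝ≥0∞)) := ⟨one_le_two⟩
  set b := stdOrthonormalBasis ℝ (EuclideanSpace ℝ ι)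
  obtain ⟨M, hM⟩ := hf.exists_norm_le
  have hft : MemLp f ∞ volume := memLp_top_of_hasBoundedDerivs hf
  have hw : ∀ i, MemLp (fun y => fderiv ℝ z y (b i)) 2 volume := fun i => hz.memLp_fderiv_apply (b i)
  have hflux : ∀ i, MemLp (fun y => ⟪f y, b i⟫ • fderiv ℝ z y (b i)) 2 volume := fun i =>
    memLp_inner_smul_of_top (b i) hft (hw i)
  -- the two integrands of the splitting are in `L²`
  have hT : ∀ i, MemLp (fun x => ⟪f x, b i⟫ • blockFn j (fun y => fderiv ℝ z y (b i)) x) 2 volume := fun i =>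
    memLp_inner_smul_of_top (b i) hft (memLp_blockFn j (hw i) one_le_two)
  have hC : ∀ i, MemLp (fun x => blockFn j (fun y => ⟪f y, b i⟫ • fderiv ℝ z y (b i)) x -
      ⟪f x, b i⟫ • blockFn j (fun y => fderiv ℝ z y (b i)) x) 2 volume := fun i =>
    (memLp_blockFn j (hflux i) one_le_two).sub (hT i)
  -- split each piece
  have hsplit : ∀ i, trilin j g (b i) f (fun y => fderiv ℝ z y (b i)) =
      (∫ x, ⟪g x, ⟪f x, b i⟫ • blockFn j (fun y => fderiv ℝ z y (b i)) x⟫) +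
      ∫ x, ⟪g x, blockFn j (fun y => ⟪f y, b i⟫ • fderiv ℝ z y (b i)) x -
        ⟪f x, b i⟫ • blockFn j (fun y => fderiv ℝ z y (b i)) x⟫ := by
    intro i
    unfold trilin
    rw [← integral_add (integrable_inner_of_memLp_two hg (hT i)) (integrable_inner_of_memLp_two hg (hC i))]
    refine integral_congr_ae (Eventually.of_forall fun x => ?_)
    dsimp only
    rw [← inner_add_right, add_sub_cancel]
  simp_rw [hsplit]
  rw [Finset.sum_add_distrib]
  congr 1
  -- the transport part: `∑_i f_i ∂_i(Δ̇_j z) = (f·∇) Δ̇_j z`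
  rw [← integral_finsetSum _ fun i _ => integrable_inner_of_memLp_two hg (hT i)]
  refine integral_congr_ae (Eventually.of_forall fun x => ?_)
  dsimp only
  rw [← inner_sum]
  congr 1
  rw [convect_eq_sum_inner_smul_fderiv f (blockFn j z) x]
  refine Finset.sum_congr rfl fun i _ => ?_
  congr 1
  exact (congrFun ((IsC1L2Field.of_isSmoothL2Field hz).fderiv_blockFn_apply j (b i)) x).symm

/-- **The commutator piece of a low–high pair** (the paper's (3.5) with Bernstein): for a smooth `L²`
field `v`, `g ∈ L²`, the low block `Δ̇_l v` (Lipschitz with constant `L_l(v) = ∑_i ‖∂_i Δ̇_l v‖_∞`,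
`BlockLipschitz.lean`) and the high block `Δ̇_{l'} v`:
`‖∫ ⟪g, Δ̇_j((Δ̇_l v)_i ∂_i Δ̇_{l'} v) - (Δ̇_l v)_i Δ̇_j ∂_i Δ̇_{l'} v⟫‖ ≤ ‖g‖₂ · L_l(v) · 2^{-j} M₁ · C_b 2^{l'} ‖Δ̇_{l'} v‖₂`,
`M₁ = ∫ |K₀(z)| ‖z‖ dz` (`LittlewoodPaleyCommutator`). [cite: CheskidovDai2015, §3.1 (3.5), estimate of I₁₁] -/
theorem enorm_integral_inner_comm_le (K : LPBounds ι) (hg : MemLp g 2 volume) (hv : IsSmoothL2Field v)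
    (i : Fin (Module.finrank ℝ (EuclideanSpace ℝ ι))) (l l' : ℤ) {L : ℝ} (hL : 0 ≤ L)
    (hLip : ∀ x y, ‖blockFn l v x - blockFn l v y‖ ≤ L * ‖x - y‖) :
    ‖∫ x, ⟪g x,
        blockFn j (fun y => ⟪blockFn l v y, stdOrthonormalBasis ℝ (EuclideanSpace ℝ ι) i⟫ •
            fderiv ℝ (blockFn l' v) y (stdOrthonormalBasis ℝ (EuclideanSpace ℝ ι) i)) x -
          ⟪blockFn l v x, stdOrthonormalBasis ℝ (EuclideanSpace ℝ ι) i⟫ •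
            blockFn j (fun y => fderiv ℝ (blockFn l' v) y (stdOrthonormalBasis ℝ (EuclideanSpace ℝ ι) i)) x⟫‖ₑ ≤
      eLpNorm g 2 volume * (ENNReal.ofReal L *
        ENNReal.ofReal ((2 : ℝ) ^ (-(j : ℝ)) * ∫ z : EuclideanSpace ℝ ι, ‖blockKernel (EuclideanSpace ℝ ι) 0 z‖ * ‖z‖) *
        (K.Cb * ENNReal.ofReal ((2 : ℝ) ^ l') * blockL2 v l')) := by
  set b := stdOrthonormalBasis ℝ (EuclideanSpace ℝ ι)
  set φ : EuclideanSpace ℝ ι → ℝ := fun y => ⟪blockFn l v y, b i⟫ with hφ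
  set w : EuclideanSpace ℝ ι → EuclideanSpace ℝ ι := fun y => fderiv ℝ (blockFn l' v) y (b i) with hw
  have hvl : HasBoundedDerivs (blockFn l v) := hv.toHasBoundedDerivs.blockFn l
  obtain ⟨M, hM⟩ := hvl.exists_norm_le
  have hwS : IsSmoothL2Field w := (hv.blockFn l').fderiv_apply (b i)
  obtain ⟨G, hG⟩ := hwS.toHasBoundedDerivs.exists_norm_le
  -- hypotheses of the commutator estimate
  have hφc : Continuous φ := hvl.continuous.inner continuous_const
  have hφM : ∀ x, ‖φ x‖ ≤ M := fun x => by
    refine (norm_inner_le_norm _ _).trans ?_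
    rw [b.orthonormal.1 i, mul_one]; exact hM x
  have hφL : ∀ x y, ‖φ x - φ y‖ ≤ L * ‖x - y‖ := fun x y => by
    simp only [hφ]
    rw [← inner_sub_left]
    refine (norm_inner_le_norm _ _).trans ?_
    rw [b.orthonormal.1 i, mul_one]; exact hLip x y
  have hcomm := eLpNorm_blockFn_smul_sub_smul_blockFn_le (E' := EuclideanSpace ℝ ι) j (p := 2) one_le_two
    hφc hφM hφL hL hwS.memLp_two hG
  -- Cauchy–Schwarz against `g`, then Bernstein on `‖∂_i Δ̇_{l'} v‖₂`
  have hmeas : AEStronglyMeasurable (fun x => blockFn j (fun y => φ y • w y) x - φ x • blockFn j w x) volume := by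
    haveI : Fact (1 ≤ (2 : ℝ≥0∞)) := ⟨one_le_two⟩
    have h1 : MemLp (fun y => φ y • w y) 2 volume := memLp_inner_smul_of_top (b i) (memLp_top_of_hasBoundedDerivs hvl) hwS.memLp_two
    exact (aestronglyMeasurable_blockFn j h1.1).sub (hφc.aestronglyMeasurable.smul (aestronglyMeasurable_blockFn j hwS.memLp_two.1))
  have hbern := K.bernstein (b i) l' v hv
  rw [b.orthonormal.1 i, mul_one] at hbern
  calc ‖∫ x, ⟪g x, blockFn j (fun y => φ y • w y) x - φ x • blockFn j w x⟫‖ₑ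
      ≤ eLpNorm g 2 volume * eLpNorm (fun x => blockFn j (fun y => φ y • w y) x - φ x • blockFn j w x) 2 volume :=
        enorm_integral_inner_le_two_two hg.1 hmeas
    _ ≤ eLpNorm g 2 volume * (ENNReal.ofReal L *
        ENNReal.ofReal ((2 : ℝ) ^ (-(j : ℝ)) * ∫ z : EuclideanSpace ℝ ι, ‖blockKernel (EuclideanSpace ℝ ι) 0 z‖ * ‖z‖) *
        eLpNorm w 2 volume) := by gcongr
    _ ≤ _ := by gcongr; exact hbern

/-- **The transport parts of the far low–high pieces cancel** (Cheskidov–Dai: "`I₁₂` vanishes since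
`div u_{≤q-2} = 0`", after "`∑_{|q-p|≤2} Δ_q u_p = u_q`"): for a divergence-free smooth `L²` field `v` on
`ℝ^ι` (`ι` nonempty) and any `l`,
`∑_{l' = j-2}^{j+2} ∫ ⟪Δ̇_j v, (Δ̇_l v·∇)(Δ̇_j Δ̇_{l'} v)⟫ = ∫ ⟪Δ̇_j v, (Δ̇_l v·∇) Δ̇_j v⟫ = 0`.
[cite: CheskidovDai2015, §3.1 (I₁₂ = 0)] -/
theorem sum_window_integral_inner_transport_eq_zero [Nonempty ι] (hv : IsSmoothL2Field v)
    (hdiv : VectorCalculus.IsDivFree v) (l : ℤ) :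
    ∑ l' ∈ Finset.Icc (j - 2) (j + 2), ∫ x, ⟪blockFn j v x, convect (blockFn l v) (blockFn j (blockFn l' v)) x⟫ = 0 := by
  haveI : Fact (1 ≤ (2 : ℝ≥0∞)) := ⟨one_le_two⟩
  have hvl : HasBoundedDerivs (blockFn l v) := hv.toHasBoundedDerivs.blockFn l
  have hjl' : ∀ l', IsSmoothL2Field (blockFn j (blockFn l' v)) := fun l' => (hv.blockFn l').blockFn j
  -- each transport integrand is integrable
  have hint : ∀ l', Integrable (fun x => ⟪blockFn j v x, convect (blockFn l v) (blockFn j (blockFn l' v)) x⟫) volume :=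
    fun l' => integrable_inner_of_memLp_two (hv.blockFn j).memLp_two ((hjl' l').convect hvl).memLp_two
  rw [← integral_finsetSum _ fun l' _ => hint l']
  -- linearity of transport in the transported field, and `∑_{window} Δ̇_j Δ̇_{l'} v = Δ̇_j v`
  have hsum : ∀ x, ∑ l' ∈ Finset.Icc (j - 2) (j + 2), ⟪blockFn j v x, convect (blockFn l v) (blockFn j (blockFn l' v)) x⟫ =
      ⟪blockFn j v x, convect (blockFn l v) (blockFn j v) x⟫ := by
    intro x
    rw [← inner_sum]
    congr 1
    have hlin : ∑ l' ∈ Finset.Icc (j - 2) (j + 2), convect (blockFn l v) (blockFn j (blockFn l' v)) x =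
        convect (blockFn l v) (∑ l' ∈ Finset.Icc (j - 2) (j + 2), blockFn j (blockFn l' v)) x := by
      simp only [convect_apply]
      rw [fderiv_sum fun l' _ => ((hjl' l').contDiff_nat 1 |>.differentiable one_ne_zero) x,
        FunLike.coe_sum, Finset.sum_apply]
    rw [hlin, ← blockFn_sum j _ fun l' _ => memLp_blockFn l' hv.memLp_two one_le_two, blockFn_sum_window_eq j hv]
  simp_rw [hsum]
  exact integral_inner_convect_eq_zero hvl (hv.toHasBoundedDerivs.isDivFree_blockFn hdiv l) (hv.blockFn j)

end Pieces

end Literature.Analysis.FluidPDE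

end
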